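import Summits.QuantumFields.BalabanUV.Beta.CombChartJointEndReflTablesAn1S2Scaled
import Summits.QuantumFields.BalabanUV.Beta.SymLamGroupScaling

/-!
# `BalabanUV.Beta.CombChartJointEndReflTablesAn1S2MScaled` — binder row D1, chart (III″) programme (an2 g56 W-3 l.63100 (D4) «WANTED leaf-04: S2Mw»): **THE κ-TWIN
# S2Mw OF THE COMB CHAIN ROOT `CombChartJointEndReflTablesAn1S2M`** in the ONE-κ currency of RULING R-D1-g56-4 ∕ A-1 l.63035 ∕ W-3 shape (S): literal
# `JsB12CombShSym hLc N (symTablesAn1S2w 3 Lc (κ·cΛ) κ) (κ·cΛ) cB` (pin `κ·cΛ` in every Λ slot, mixed table `κ • symMixFFAt (ctr 4 Lc) Lc` in every second-order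
# slot), the mixed reflection remainder `κ • symRMrAn1 Lc cΛ γ` discharged by an2's `SymLamGroupScaling.hM2_smul_symMixFFAt` over leaf-04's S2w.
# WHAT CHANGES relative to `CombChartJointEndReflTablesAn1S2M`: nothing but these substitutions (text transformed by name; the parent's bound fine-bond index `κ`
# is renamed `κ₁`; see the parent and its chart-(II) original `RowD1JointEndSymReflTablesAn1S2M` for the letter-by-letter account).

HONEST FRAMING (cell contract, verbatim): «discharging `BetaPertH` makes Bałaban's UV stability UNCONDITIONAL — a real constructive-QFT
result; it is NOT the continuum limit and NOT the Clay problem.»  HONEST DEPENDENCY: continuum YM on T⁴ ⇐ BetaPertH ∧ nine spine estimates (0/9 proved);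
BetaPertH ⇐ (D1) ∧ (D4) ∧ CAP+tail; G-an2-4 gates asym, D1 and NE2/3/4.
DERIVED cell leaf ([folklore] wiring BY NAME; β sub-cell, D1 formalisation swarm leaf prover 04 `b2b-balaban-beta-d1-formalise-leaf-04` gen 33, on the row
OWNER an2 g56's WANTED (D4)).  No statement of Bałaban's papers, no `[cite:]`, no `Prop` fact, no `def`; every displayed letter is a BINDER; the VALUE
`κ = Lc¹²∕4` enters nowhere here (the chain is κ-generic; W-3 (S) CONSEQUENCE).  HONEST: composition by name; root classes 0∕4 discharged; row D1 binders 0∕4;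
ROOT M‴ p325680 and the root of record untouched; NOT D1, NOT `BetaPertH`, NOT continuum, NOT Clay.  Provenance: β sub-cell, unit
b2b-balaban-beta-d1-formalise-leaf-04 gen 33, 2026-08-25 (v1); over leaf-04's `CombChartJointEndReflTablesAn1S2Scaled` (S2w) and an2 g56's `SymLamGroupScaling`
BY NAME; no existing file touched.
-/

noncomputable section

open Finset
open scoped BigOperators
open Literature.Probability.LatticeModels (Torus.proj)
open Literature.MathematicalPhysics.QuantumFieldTheory
open Literature.MathematicalPhysics.QuantumFieldTheory.Balaban1983to89
open Literature.MathematicalPhysics.QuantumFieldTheory.Balaban1983to89.Beta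
open Literature.MathematicalPhysics.QuantumFieldTheory.Balaban1983to89.Beta.VectorTailsLoc (fam kfam)
open Literature.MathematicalPhysics.QuantumFieldTheory.Balaban1983to89.Beta.VectorLegVolumeAdapter (MvE)
open ExpKernelCalculus (MKer BiLoc VertexFamily comp tr tadpole shiftK)
open PolarizationSign (reflSign WardTransversal AxisReflectionCovariant)
open KernelReflection (refK)
open ResolventReflection (bref Φ)
open AffineAveraging (box toSite)
open AveragingContoursRooted (ctr ctrOff ctrOff_mem_box)
open OneStepResolventKernel (Fib LocStencil JetData)
open OneStepKernelFamily (KInvStep colH vertexOfK TbalOf flipK D1Tel D1Rep D1Drift)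
open KernelWard (divV divW)
open StepJetData (mfNeg wilsonA)
open BalabanStepJetsSucc (mmRead wE wVH)
open SecondOrderResponse (dM W2OfK LocStencilFM)
open BalabanCompositeJets (LocStencil₂)
open BalabanStepW2 (M2Of wB2 wV4)
open WilsonBiStencil (wilsonW₂)
open WilsonVertex2Sym (wsym22)
open Summit.QuantumFields.BalabanUV.Beta.TameKernelCalculus
open Summit.QuantumFields.BalabanUV.Beta.ChartConjugation (conjV conjW)
open Summit.QuantumFields.BalabanUV.Beta.ChartConjugationDefectEnd (conjDefect sandwichDefect)
open Summit.QuantumFields.BalabanUV.Beta.AxialDressingRooted (one_le_of_neZero)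
open Summit.QuantumFields.BalabanUV.Beta.SymmetrisedDressingKernel (coDressKSymAt)
open Summit.QuantumFields.BalabanUV.Beta.AveragingWardRootedStencils (legInd)
open Summit.QuantumFields.BalabanUV.Beta.SymmetrisedStepJets (SymTables)
open Summit.QuantumFields.BalabanUV.Beta.CombChartStepJets (GcombSh ScombOf SpureCombOf JsB12CombSh0)
open Summit.QuantumFields.BalabanUV.Beta.CombChartJointEnd (JsB12CombShSym)
open Summit.QuantumFields.BalabanUV.Beta.SpineRooted (M1Of SpureRecOf T2RecOf WrecOf)
open Summit.QuantumFields.BalabanUV.Beta.WardLocusRecursive (SrecOf)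
open Summit.QuantumFields.BalabanUV.Beta.WardLocusCubic (mmSym)
open Summit.QuantumFields.BalabanUV.Beta.SymShiftedSpread (bhKStepSh)
open Summit.QuantumFields.BalabanUV.Beta.BorderedHessian (sgnK bhK stepScale diagK)
open Summit.QuantumFields.BalabanUV.Beta.E3ContactGenerator (ctGenM)
open Summit.QuantumFields.BalabanUV.Beta.DshAn1 (Dsh)
open Summit.QuantumFields.BalabanUV.Beta.SymAveragingHessianCounts (symVhSAt symHessFFAt)
open Summit.QuantumFields.BalabanUV.Beta.SymAveragingMixedJetTables (symMixFFAt)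
open Summit.QuantumFields.BalabanUV.Beta.SymSecondOrderTablesAn1 (symVh₂SAn1)
open Summit.QuantumFields.BalabanUV.Beta.SymTablesAn1S2Weighted (symTablesAn1S2w)
open Summit.QuantumFields.BalabanUV.Beta.CombChartJointEndReflTablesAn1S2Scaled (d1Drift_JsB12CombShSym_an1TablesS2w_of_bordMixLetters_reflTableLettersRem_D1Tel_D1Rep)
open Summit.QuantumFields.BalabanUV.Beta.SymMixedReflectionLetterAn1 (symRMrAn1)
open Summit.QuantumFields.BalabanUV.Beta.SymLamGroupScaling (hM2_smul_symMixFFAt)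

namespace Summit.QuantumFields.BalabanUV.Beta.CombChartJointEndReflTablesAn1S2MScaled

variable {Lc : ℕ} [NeZero Lc]

/-- **ROW D1 — THE LITERAL ROOT AT THE WEIGHTED RECORD `symTablesAn1S2w 3 Lc (κ·cΛ) κ` WITH THE hR MIXED TABLE REFLECTION LETTER (hM2) DISCHARGED, ONE-κ
CURRENCY** — the κ-twin of `CombChartJointEndReflTablesAn1S2M.d1Drift_…an1TablesS2_of_bordMixWard_…`: S2w (`CombChartJointEndReflTablesAn1S2Scaled`) at pin `κ·cΛ`
and mixed weight `κ`, with `RMr := κ • symRMrAn1 Lc cΛ γ` and `hM2 := SymLamGroupScaling.hM2_smul_symMixFFAt hLc κ cΛ γ` (the row OWNER an2 g56's scaled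
mixed reflection letter — an1's packed law `symTableLaw` repacked and scaled) — two binders fewer than S2w; `κ • symRMrAn1 Lc cΛ γ` now appears explicitly in
`hsplit`.  Every pin slot of the parent (`SpureRecOf … cΛ`, `M1Of … cΛ`, the record, the family `JsB12CombShSym … cΛ cB`) reads `κ·cΛ`; every mixed slot reads
`κ • symMixFFAt ρ_c Lc`; the remainder is `κ •` the landed one at `cΛ` (RULING R-D1-g56-4 ∕ A-1 l.63035 ∕ W-3 l.63100 shape (S)); NO lock yet (it enters at
MWw); the parent's bound fine-bond index is renamed `κ₁`.  At `κ = 1` this is the parent's statement.  HONEST: composition by name; 0∕5 root-level classes;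
NOT D1. -/
theorem d1Drift_JsB12CombShSym_an1TablesS2w_of_bordMixWard_bordReflLetters_D1Tel_D1Rep (hLc : Odd Lc) (hL2 : 2 ≤ Lc) {N : ℕ} (hN : 2 ≤ N) (cΛ κ cB : ℝ)
    -- (the two SECOND-ORDER sym tables are an1's S2b words `symVh₂SAn1 3 Lc` ∕ `symMixFFAt ρ_c Lc`, inside the closed record `symTablesAn1S2w 3 Lc (κ * cΛ) κ`)
    -- the second-order TABLE letters' remainders, their classes (one rate per level) and row parities
    (RB RB'' : ℕ → (Fin 4 → ℤ) → Fin 4 → (Fin 4 → ℤ) → MKer 4 (Fib 3))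
    (RM : ℕ → (Fin 4 → ℤ) → Fin 4 → (Fin 4 → ℤ) → MKer 4 (Fib 3))
    (hcls0 : ∃ C δ : ℝ, 0 < δ ∧ (∀ Y, LocStencil (RB 0 Y) C δ) ∧ (∀ Y, LocStencil (RB'' 0 Y) C δ) ∧ (∀ y, VertexFamily (RM 0 y) Lc C δ))
    (hclsS : ∀ j : ℕ, ∃ C δ : ℝ, 0 < δ ∧ (∀ Y, LocStencil (RB (j + 1) Y) C δ) ∧ (∀ Y, LocStencil (RB'' (j + 1) Y) C δ) ∧
      (∀ y, VertexFamily (RM (j + 1) y) Lc C δ))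
    (hRBp : ∀ j Y κ₁ u, trK (RB j Y κ₁ u) = -sgnK (RB j Y κ₁ u)) (hRB''p : ∀ j Y κ₁ u, trK (RB'' j Y κ₁ u) = -sgnK (RB'' j Y κ₁ u))
    (hRMp : ∀ j y ρ' w, trK (RM j y ρ' w) = -sgnK (RM j y ρ' w))
    -- (T2-B) the Ward law of the second-order border table `vh₂S` against an1's `symVhSAt ρ_c`, both slots, level 0 and level j+1
    (hBord0 : ∀ (Y : Fin 4 → ℤ) (κ₁' : Fin 4) (u' : Fin 4 → ℤ),
      (stepScale 3 Lc 0 * (Lc : ℝ) ^ (3 + 1))⁻¹ • ∑ v ∈ box (3 + 1) Lc, divV (fun κ₁ u => cB • symVh₂SAn1 3 Lc κ₁ u κ₁' u') ((Lc : ℤ) • Y + toSite v) =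
        comp ((-((Lc : ℝ) ^ (3 + 1) * (1 / 2) * (Lc : ℝ) ^ (3 + 1))) • symVhSAt (ctr 4 Lc) 3 Lc rfl κ₁' u')
            (diagK ((1 / 2 : ℝ) • ∑ v ∈ box (3 + 1) Lc, legInd (ctr (3 + 1) Lc) ((Lc : ℤ) • Y + toSite v)))
          - comp (diagK ((1 / 2 : ℝ) • ∑ v ∈ box (3 + 1) Lc, legInd (ctr (3 + 1) Lc) ((Lc : ℤ) • Y + toSite v)))
            ((-((Lc : ℝ) ^ (3 + 1) * (1 / 2) * (Lc : ℝ) ^ (3 + 1))) • symVhSAt (ctr 4 Lc) 3 Lc rfl κ₁' u') + RB 0 Y κ₁' u')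
    (hBord0'' : ∀ (Y : Fin 4 → ℤ) (κ₁ : Fin 4) (u : Fin 4 → ℤ),
      (stepScale 3 Lc 0 * (Lc : ℝ) ^ (3 + 1))⁻¹ • ∑ v ∈ box (3 + 1) Lc, divV (fun κ₁' u' => cB • symVh₂SAn1 3 Lc κ₁ u κ₁' u') ((Lc : ℤ) • Y + toSite v) =
        comp ((-((Lc : ℝ) ^ (3 + 1) * (1 / 2) * (Lc : ℝ) ^ (3 + 1))) • symVhSAt (ctr 4 Lc) 3 Lc rfl κ₁ u)
            (diagK ((1 / 2 : ℝ) • ∑ v ∈ box (3 + 1) Lc, legInd (ctr (3 + 1) Lc) ((Lc : ℤ) • Y + toSite v)))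
          - comp (diagK ((1 / 2 : ℝ) • ∑ v ∈ box (3 + 1) Lc, legInd (ctr (3 + 1) Lc) ((Lc : ℤ) • Y + toSite v)))
            ((-((Lc : ℝ) ^ (3 + 1) * (1 / 2) * (Lc : ℝ) ^ (3 + 1))) • symVhSAt (ctr 4 Lc) 3 Lc rfl κ₁ u) + RB'' 0 Y κ₁ u)
    (hBordS : ∀ (j : ℕ) (Y : Fin 4 → ℤ) (κ₁' : Fin 4) (u' : Fin 4 → ℤ),
      (stepScale 3 Lc (j + 1) * (Lc : ℝ) ^ (3 + 1))⁻¹ • ∑ v ∈ box (3 + 1) Lc, divV (fun κ₁ u => (cB * wB2 3 Lc (j + 1)) • symVh₂SAn1 3 Lc κ₁ u κ₁' u') ((Lc : ℤ) • Y + toSite v) =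
        comp (((-((Lc : ℝ) ^ (3 + 1) * (1 / 2) * (Lc : ℝ) ^ (3 + 1))) * wVH 3 Lc (j + 1)) • symVhSAt (ctr 4 Lc) 3 Lc rfl κ₁' u')
            (diagK ((1 / 2 : ℝ) • ∑ v ∈ box (3 + 1) Lc, legInd (ctr (3 + 1) Lc) ((Lc : ℤ) • Y + toSite v)))
          - comp (diagK ((1 / 2 : ℝ) • ∑ v ∈ box (3 + 1) Lc, legInd (ctr (3 + 1) Lc) ((Lc : ℤ) • Y + toSite v)))
            (((-((Lc : ℝ) ^ (3 + 1) * (1 / 2) * (Lc : ℝ) ^ (3 + 1))) * wVH 3 Lc (j + 1)) • symVhSAt (ctr 4 Lc) 3 Lc rfl κ₁' u') + RB (j + 1) Y κ₁' u')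
    (hBordS'' : ∀ (j : ℕ) (Y : Fin 4 → ℤ) (κ₁ : Fin 4) (u : Fin 4 → ℤ),
      (stepScale 3 Lc (j + 1) * (Lc : ℝ) ^ (3 + 1))⁻¹ • ∑ v ∈ box (3 + 1) Lc, divV (fun κ₁' u' => (cB * wB2 3 Lc (j + 1)) • symVh₂SAn1 3 Lc κ₁ u κ₁' u') ((Lc : ℤ) • Y + toSite v) =
        comp (((-((Lc : ℝ) ^ (3 + 1) * (1 / 2) * (Lc : ℝ) ^ (3 + 1))) * wVH 3 Lc (j + 1)) • symVhSAt (ctr 4 Lc) 3 Lc rfl κ₁ u)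
            (diagK ((1 / 2 : ℝ) • ∑ v ∈ box (3 + 1) Lc, legInd (ctr (3 + 1) Lc) ((Lc : ℤ) • Y + toSite v)))
          - comp (diagK ((1 / 2 : ℝ) • ∑ v ∈ box (3 + 1) Lc, legInd (ctr (3 + 1) Lc) ((Lc : ℤ) • Y + toSite v)))
            (((-((Lc : ℝ) ^ (3 + 1) * (1 / 2) * (Lc : ℝ) ^ (3 + 1))) * wVH 3 Lc (j + 1)) • symVhSAt (ctr 4 Lc) 3 Lc rfl κ₁ u) + RB'' (j + 1) Y κ₁ u)
    -- (T2-M₂) the Ward law of the mixed table `M2Of 3 Lc (κ • symMixFFAt (ctr 4 Lc) Lc) j` against `M1Of 3 Lc (symHessFFAt ρ_c Lc) (κ * cΛ) j`, every level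
    (hM₂ : ∀ (j : ℕ) (y : Fin 4 → ℤ) (ρ' : Fin 4) (w : Fin 4 → ℤ),
      (stepScale 3 Lc j * (Lc : ℝ) ^ (3 + 1))⁻¹ • ∑ v ∈ box (3 + 1) Lc, divV (fun κ₁ u => M2Of 3 Lc (κ • symMixFFAt (ctr 4 Lc) Lc) j κ₁ u ρ' w) ((Lc : ℤ) • y + toSite v) =
        comp (M1Of 3 Lc (symHessFFAt (ctr 4 Lc) Lc) (κ * cΛ) j ρ' w) (diagK ((1 / 2 : ℝ) • ∑ v ∈ box (3 + 1) Lc, legInd (ctr (3 + 1) Lc) ((Lc : ℤ) • y + toSite v)))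
          - comp (diagK ((1 / 2 : ℝ) • ∑ v ∈ box (3 + 1) Lc, legInd (ctr (3 + 1) Lc) ((Lc : ℤ) • y + toSite v))) (M1Of 3 Lc (symHessFFAt (ctr 4 Lc) Lc) (κ * cΛ) j ρ' w)
          + RM j y ρ' w)
    -- hR, first order: the REFLECTION letters (V-r)(H-r) of an1's concrete first-order sym tables (pinned contact generator) — an1's reflection step, displayed
    (hVfm : ∀ (α κ₁' : Fin 4) (u x z : Fin 4 → ℤ) (β m : Fin 4), symVhSAt (ctr 4 Lc) 3 Lc rfl κ₁' (bref α κ₁' u) x z (Sum.inl β) (Sum.inr m) =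
      (reflSign α κ₁' • refK (Φ (d := 3) Lc α) (symVhSAt (ctr 4 Lc) 3 Lc rfl κ₁' u + conjV (bhK (d := 3) Lc + Dsh Lc)
        ((((Lc : ℝ) ^ 4)⁻¹) • diagK (ctGenM 3 (bhK Lc + Dsh Lc) α Lc κ₁' u)))) x z (Sum.inl β) (Sum.inr m))
    (hVmf : ∀ (α κ₁' : Fin 4) (u x z : Fin 4 → ℤ) (m β : Fin 4), symVhSAt (ctr 4 Lc) 3 Lc rfl κ₁' (bref α κ₁' u) x z (Sum.inr m) (Sum.inl β) =
      (reflSign α κ₁' • refK (Φ (d := 3) Lc α) (symVhSAt (ctr 4 Lc) 3 Lc rfl κ₁' u + conjV (bhK (d := 3) Lc + Dsh Lc)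
        ((((Lc : ℝ) ^ 4)⁻¹) • diagK (ctGenM 3 (bhK Lc + Dsh Lc) α Lc κ₁' u)))) x z (Sum.inr m) (Sum.inl β))
    (hVmm : ∀ (α κ₁' : Fin 4) (u x z : Fin 4 → ℤ) (m m' : Fin 4), symVhSAt (ctr 4 Lc) 3 Lc rfl κ₁' (bref α κ₁' u) x z (Sum.inr m) (Sum.inr m') =
      (reflSign α κ₁' • refK (Φ (d := 3) Lc α) (symVhSAt (ctr 4 Lc) 3 Lc rfl κ₁' u + conjV (bhK (d := 3) Lc + Dsh Lc)
        ((((Lc : ℝ) ^ 4)⁻¹) • diagK (ctGenM 3 (bhK Lc + Dsh Lc) α Lc κ₁' u)))) x z (Sum.inr m) (Sum.inr m'))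
    (hHr : ∀ (α μ : Fin 4) (y : Fin 4 → ℤ),
      symHessFFAt (ctr 4 Lc) Lc μ (bref α μ y) = reflSign α μ • refK (Φ (d := 3) Lc α) (symHessFFAt (ctr 4 Lc) Lc μ y))
    -- the first-order contact coefficient, displayed
    (γ : ℕ → ℝ) (hγ : ∀ j, γ j = -((Lc : ℝ) ^ 8 / 2) * wVH 3 Lc j / (stepScale 3 Lc j * (Lc : ℝ) ^ 4))
    -- hR, SECOND ORDER, NOW TABLE-LEVEL: (hB0) the border table's zero field block, the second units lock, and the second-order TABLE reflection letters
    -- (level-0 letter, mixed letter ∀ j, border letter ∀ j+1), the mechanical split identities + localisations, the remainder recursion (with the four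
    -- inner sandwich-defect words of `SecondOrderInverseShapeDefect.K3_sharp_defect`) — the hypotheses of `SpineRooted.WrecOf_brefC_of_tableLetters_comb`
    (hlock2 : ∀ j, ((Lc : ℝ) ^ 8) * wV4 3 Lc (j + 1) * wVH 3 Lc (j + 1) = ((Lc : ℝ) ^ 4 * wE 3 Lc (j + 1)) ^ 2)
    (h2 : ℕ → Fin 4 → Fin 4 → (Fin 4 → ℤ) → Fin 4 → (Fin 4 → ℤ) → (Fin 4 → ℤ) → Fib 3 → ℝ)
    (R2 : ℕ → Fin 4 → Fin 4 → (Fin 4 → ℤ) → Fin 4 → (Fin 4 → ℤ) → MKer 4 (Fib 3))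
    (h0 : ∀ (α κ₁ : Fin 4) (u : Fin 4 → ℤ) (κ₁' : Fin 4) (u' : Fin 4 → ℤ),
      T2RecOf 3 Lc (GcombSh Lc) (SpureRecOf 3 Lc (symVhSAt (ctr 4 Lc) 3 Lc rfl) (symHessFFAt (ctr 4 Lc) Lc) (GcombSh Lc) ((Lc : ℝ) ^ 4) (-((Lc : ℝ) ^ 8 / 2)) (κ * cΛ)) (M1Of 3 Lc (symHessFFAt (ctr 4 Lc) Lc) (κ * cΛ)) ((Lc : ℝ) ^ 8) cB ((8 * (N : ℝ) ^ 2)⁻¹ • wsym22 N) (symVh₂SAn1 3 Lc) (κ • symMixFFAt (ctr 4 Lc) Lc) 0 κ₁ (bref α κ₁ u) κ₁' (bref α κ₁' u') =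
        (reflSign α κ₁ * reflSign α κ₁') • refK (Φ Lc α)
          (T2RecOf 3 Lc (GcombSh Lc) (SpureRecOf 3 Lc (symVhSAt (ctr 4 Lc) 3 Lc rfl) (symHessFFAt (ctr 4 Lc) Lc) (GcombSh Lc) ((Lc : ℝ) ^ 4) (-((Lc : ℝ) ^ 8 / 2)) (κ * cΛ)) (M1Of 3 Lc (symHessFFAt (ctr 4 Lc) Lc) (κ * cΛ)) ((Lc : ℝ) ^ 8) cB ((8 * (N : ℝ) ^ 2)⁻¹ • wsym22 N) (symVh₂SAn1 3 Lc) (κ • symMixFFAt (ctr 4 Lc) Lc) 0 κ₁ u κ₁' u' +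
            conjW (bhKStepSh 3 Lc (Dsh Lc) 0) (SpureRecOf 3 Lc (symVhSAt (ctr 4 Lc) 3 Lc rfl) (symHessFFAt (ctr 4 Lc) Lc) (GcombSh Lc) ((Lc : ℝ) ^ 4) (-((Lc : ℝ) ^ 8 / 2)) (κ * cΛ) 0 κ₁ u) (SpureRecOf 3 Lc (symVhSAt (ctr 4 Lc) 3 Lc rfl) (symHessFFAt (ctr 4 Lc) Lc) (GcombSh Lc) ((Lc : ℝ) ^ 4) (-((Lc : ℝ) ^ 8 / 2)) (κ * cΛ) 0 κ₁' u')
              (diagK fun p c => γ 0 * ctGenM 3 (bhK Lc + Dsh Lc) α Lc κ₁ u p c) (diagK fun p c => γ 0 * ctGenM 3 (bhK Lc + Dsh Lc) α Lc κ₁' u' p c) (diagK (h2 0 α κ₁ u κ₁' u')) +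
            R2 0 α κ₁ u κ₁' u'))
    (X2s : ℕ → Fin 4 → Fin 4 → (Fin 4 → ℤ) → Fin 4 → (Fin 4 → ℤ) → (Fin 4 → ℤ) → Fib 3 → ℝ)
    (Δ : ℕ → Fin 4 → Fin 4 → (Fin 4 → ℤ) → Fin 4 → (Fin 4 → ℤ) → MKer 4 (Fib 3))
    (hsplit : ∀ (j : ℕ) (α μ : Fin 4) (y : Fin 4 → ℤ) (ν : Fin 4) (y' : Fin 4 → ℤ),
      W2OfK (GcombSh (d := 3) Lc j) Lc
          (fun κ₁ u => SpureRecOf 3 Lc (symVhSAt (ctr 4 Lc) 3 Lc rfl) (symHessFFAt (ctr 4 Lc) Lc) (GcombSh Lc) ((Lc : ℝ) ^ 4) (-((Lc : ℝ) ^ 8 / 2)) (κ * cΛ) j κ₁ u + conjV (bhKStepSh 3 Lc (Dsh Lc) j) (diagK fun p c => γ j * ctGenM 3 (bhK Lc + Dsh Lc) α Lc κ₁ u p c))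
          (M1Of 3 Lc (symHessFFAt (ctr 4 Lc) Lc) (κ * cΛ) j)
          (fun κ₁ u κ₁' u' => T2RecOf 3 Lc (GcombSh Lc) (SpureRecOf 3 Lc (symVhSAt (ctr 4 Lc) 3 Lc rfl) (symHessFFAt (ctr 4 Lc) Lc) (GcombSh Lc) ((Lc : ℝ) ^ 4) (-((Lc : ℝ) ^ 8 / 2)) (κ * cΛ)) (M1Of 3 Lc (symHessFFAt (ctr 4 Lc) Lc) (κ * cΛ)) ((Lc : ℝ) ^ 8) cB ((8 * (N : ℝ) ^ 2)⁻¹ • wsym22 N) (symVh₂SAn1 3 Lc) (κ • symMixFFAt (ctr 4 Lc) Lc) j κ₁ u κ₁' u' +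
            conjW (bhKStepSh 3 Lc (Dsh Lc) j) (SpureRecOf 3 Lc (symVhSAt (ctr 4 Lc) 3 Lc rfl) (symHessFFAt (ctr 4 Lc) Lc) (GcombSh Lc) ((Lc : ℝ) ^ 4) (-((Lc : ℝ) ^ 8 / 2)) (κ * cΛ) j κ₁ u) (SpureRecOf 3 Lc (symVhSAt (ctr 4 Lc) 3 Lc rfl) (symHessFFAt (ctr 4 Lc) Lc) (GcombSh Lc) ((Lc : ℝ) ^ 4) (-((Lc : ℝ) ^ 8 / 2)) (κ * cΛ) j κ₁' u')
              (diagK fun p c => γ j * ctGenM 3 (bhK Lc + Dsh Lc) α Lc κ₁ u p c) (diagK fun p c => γ j * ctGenM 3 (bhK Lc + Dsh Lc) α Lc κ₁' u' p c) (diagK (h2 j α κ₁ u κ₁' u')) +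
            R2 j α κ₁ u κ₁' u')
          (fun κ₁ u ρ w => M2Of 3 Lc (κ • symMixFFAt (ctr 4 Lc) Lc) j κ₁ u ρ w + conjV (M1Of 3 Lc (symHessFFAt (ctr 4 Lc) Lc) (κ * cΛ) j ρ w) (diagK fun p c => γ j * ctGenM 3 (bhK Lc + Dsh Lc) α Lc κ₁ u p c) + κ • symRMrAn1 Lc cΛ γ j α κ₁ u ρ w)
          μ y ν y' =
        W2OfK (GcombSh (d := 3) Lc j) Lc (SpureRecOf 3 Lc (symVhSAt (ctr 4 Lc) 3 Lc rfl) (symHessFFAt (ctr 4 Lc) Lc) (GcombSh Lc) ((Lc : ℝ) ^ 4) (-((Lc : ℝ) ^ 8 / 2)) (κ * cΛ) j) (M1Of 3 Lc (symHessFFAt (ctr 4 Lc) Lc) (κ * cΛ) j)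
            (T2RecOf 3 Lc (GcombSh Lc) (SpureRecOf 3 Lc (symVhSAt (ctr 4 Lc) 3 Lc rfl) (symHessFFAt (ctr 4 Lc) Lc) (GcombSh Lc) ((Lc : ℝ) ^ 4) (-((Lc : ℝ) ^ 8 / 2)) (κ * cΛ)) (M1Of 3 Lc (symHessFFAt (ctr 4 Lc) Lc) (κ * cΛ)) ((Lc : ℝ) ^ 8) cB ((8 * (N : ℝ) ^ 2)⁻¹ • wsym22 N) (symVh₂SAn1 3 Lc) (κ • symMixFFAt (ctr 4 Lc) Lc) j)
            (M2Of 3 Lc (κ • symMixFFAt (ctr 4 Lc) Lc) j) μ y ν y' +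
          conjW (bhKStepSh 3 Lc (Dsh Lc) j)
            (dM (GcombSh Lc j) Lc (SpureRecOf 3 Lc (symVhSAt (ctr 4 Lc) 3 Lc rfl) (symHessFFAt (ctr 4 Lc) Lc) (GcombSh Lc) ((Lc : ℝ) ^ 4) (-((Lc : ℝ) ^ 8 / 2)) (κ * cΛ) j) (M1Of 3 Lc (symHessFFAt (ctr 4 Lc) Lc) (κ * cΛ) j) μ y)
            (dM (GcombSh Lc j) Lc (SpureRecOf 3 Lc (symVhSAt (ctr 4 Lc) 3 Lc rfl) (symHessFFAt (ctr 4 Lc) Lc) (GcombSh Lc) ((Lc : ℝ) ^ 4) (-((Lc : ℝ) ^ 8 / 2)) (κ * cΛ) j) (M1Of 3 Lc (symHessFFAt (ctr 4 Lc) Lc) (κ * cΛ) j) ν y')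
            (diagK fun p c => ∑ κ₁, ∑' u, colH (GcombSh Lc j) Lc μ y κ₁ u * (γ j * ctGenM 3 (bhK Lc + Dsh Lc) α Lc κ₁ u p c))
            (diagK fun p c => ∑ κ₁, ∑' u, colH (GcombSh Lc j) Lc ν y' κ₁ u * (γ j * ctGenM 3 (bhK Lc + Dsh Lc) α Lc κ₁ u p c))
            (diagK (X2s j α μ y ν y')) +
          Δ j α μ y ν y')
    (hDg : ∀ (j : ℕ) (α ν : Fin 4) (y' : Fin 4 → ℤ),
      Loc (dM (GcombSh (d := 3) Lc j) Lc (fun κ₁ u => SpureRecOf 3 Lc (symVhSAt (ctr 4 Lc) 3 Lc rfl) (symHessFFAt (ctr 4 Lc) Lc) (GcombSh Lc) ((Lc : ℝ) ^ 4) (-((Lc : ℝ) ^ 8 / 2)) (κ * cΛ) j κ₁ u + conjV (bhKStepSh 3 Lc (Dsh Lc) j) (diagK fun p c => γ j * ctGenM 3 (bhK Lc + Dsh Lc) α Lc κ₁ u p c)) (M1Of 3 Lc (symHessFFAt (ctr 4 Lc) Lc) (κ * cΛ) j) ν y'))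
    (hX2L : ∀ j α μ y ν y', Loc (diagK (X2s j α μ y ν y'))) (hΔL : ∀ j α μ y ν y', Loc (Δ j α μ y ν y'))
    (RBr : ℕ → Fin 4 → Fin 4 → (Fin 4 → ℤ) → Fin 4 → (Fin 4 → ℤ) → MKer 4 (Fib 3))
    (hRBrff : ∀ j α κ₁ u κ₁' u' (x z : Fin 4 → ℤ) (β β' : Fin 4), RBr j α κ₁ u κ₁' u' x z (Sum.inl β) (Sum.inl β') = 0)
    (hBfm : ∀ (j : ℕ) (α : Fin 4) κ₁ u κ₁' u' (x z : Fin 4 → ℤ) (β m : Fin 4),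
      ((cB * wB2 3 Lc (j + 1)) • symVh₂SAn1 3 Lc κ₁ (bref α κ₁ u) κ₁' (bref α κ₁' u')) x z (Sum.inl β) (Sum.inr m) =
        ((reflSign α κ₁ * reflSign α κ₁') • refK (Φ Lc α) ((cB * wB2 3 Lc (j + 1)) • symVh₂SAn1 3 Lc κ₁ u κ₁' u' +
          conjW (bhKStepSh 3 Lc (Dsh Lc) (j + 1)) (SpureRecOf 3 Lc (symVhSAt (ctr 4 Lc) 3 Lc rfl) (symHessFFAt (ctr 4 Lc) Lc) (GcombSh Lc) ((Lc : ℝ) ^ 4) (-((Lc : ℝ) ^ 8 / 2)) (κ * cΛ) (j + 1) κ₁ u) (SpureRecOf 3 Lc (symVhSAt (ctr 4 Lc) 3 Lc rfl) (symHessFFAt (ctr 4 Lc) Lc) (GcombSh Lc) ((Lc : ℝ) ^ 4) (-((Lc : ℝ) ^ 8 / 2)) (κ * cΛ) (j + 1) κ₁' u')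
            (diagK fun p c => γ (j + 1) * ctGenM 3 (bhK Lc + Dsh Lc) α Lc κ₁ u p c) (diagK fun p c => γ (j + 1) * ctGenM 3 (bhK Lc + Dsh Lc) α Lc κ₁' u' p c)
            (diagK (h2 (j + 1) α κ₁ u κ₁' u')) + RBr (j + 1) α κ₁ u κ₁' u')) x z (Sum.inl β) (Sum.inr m))
    (hBmf : ∀ (j : ℕ) (α : Fin 4) κ₁ u κ₁' u' (x z : Fin 4 → ℤ) (m β : Fin 4),
      ((cB * wB2 3 Lc (j + 1)) • symVh₂SAn1 3 Lc κ₁ (bref α κ₁ u) κ₁' (bref α κ₁' u')) x z (Sum.inr m) (Sum.inl β) =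
        ((reflSign α κ₁ * reflSign α κ₁') • refK (Φ Lc α) ((cB * wB2 3 Lc (j + 1)) • symVh₂SAn1 3 Lc κ₁ u κ₁' u' +
          conjW (bhKStepSh 3 Lc (Dsh Lc) (j + 1)) (SpureRecOf 3 Lc (symVhSAt (ctr 4 Lc) 3 Lc rfl) (symHessFFAt (ctr 4 Lc) Lc) (GcombSh Lc) ((Lc : ℝ) ^ 4) (-((Lc : ℝ) ^ 8 / 2)) (κ * cΛ) (j + 1) κ₁ u) (SpureRecOf 3 Lc (symVhSAt (ctr 4 Lc) 3 Lc rfl) (symHessFFAt (ctr 4 Lc) Lc) (GcombSh Lc) ((Lc : ℝ) ^ 4) (-((Lc : ℝ) ^ 8 / 2)) (κ * cΛ) (j + 1) κ₁' u')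
            (diagK fun p c => γ (j + 1) * ctGenM 3 (bhK Lc + Dsh Lc) α Lc κ₁ u p c) (diagK fun p c => γ (j + 1) * ctGenM 3 (bhK Lc + Dsh Lc) α Lc κ₁' u' p c)
            (diagK (h2 (j + 1) α κ₁ u κ₁' u')) + RBr (j + 1) α κ₁ u κ₁' u')) x z (Sum.inr m) (Sum.inl β))
    (hBmm : ∀ (j : ℕ) (α : Fin 4) κ₁ u κ₁' u' (x z : Fin 4 → ℤ) (m m' : Fin 4),
      ((cB * wB2 3 Lc (j + 1)) • symVh₂SAn1 3 Lc κ₁ (bref α κ₁ u) κ₁' (bref α κ₁' u')) x z (Sum.inr m) (Sum.inr m') =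
        ((reflSign α κ₁ * reflSign α κ₁') • refK (Φ Lc α) ((cB * wB2 3 Lc (j + 1)) • symVh₂SAn1 3 Lc κ₁ u κ₁' u' +
          conjW (bhKStepSh 3 Lc (Dsh Lc) (j + 1)) (SpureRecOf 3 Lc (symVhSAt (ctr 4 Lc) 3 Lc rfl) (symHessFFAt (ctr 4 Lc) Lc) (GcombSh Lc) ((Lc : ℝ) ^ 4) (-((Lc : ℝ) ^ 8 / 2)) (κ * cΛ) (j + 1) κ₁ u) (SpureRecOf 3 Lc (symVhSAt (ctr 4 Lc) 3 Lc rfl) (symHessFFAt (ctr 4 Lc) Lc) (GcombSh Lc) ((Lc : ℝ) ^ 4) (-((Lc : ℝ) ^ 8 / 2)) (κ * cΛ) (j + 1) κ₁' u')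
            (diagK fun p c => γ (j + 1) * ctGenM 3 (bhK Lc + Dsh Lc) α Lc κ₁ u p c) (diagK fun p c => γ (j + 1) * ctGenM 3 (bhK Lc + Dsh Lc) α Lc κ₁' u' p c)
            (diagK (h2 (j + 1) α κ₁ u κ₁' u')) + RBr (j + 1) α κ₁ u κ₁' u')) x z (Sum.inr m) (Sum.inr m'))
    (hR2succ : ∀ (j : ℕ) (α κ₁ : Fin 4) (u : Fin 4 → ℤ) (κ₁' : Fin 4) (u' : Fin 4 → ℤ),
      R2 (j + 1) α κ₁ u κ₁' u' =
          (-((((Lc : ℝ) ^ 8) * wV4 3 Lc (j + 1)) • mmRead Lc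
              (comp (comp (GcombSh Lc j) (((1 / 2 : ℝ) • conjV (bhKStepSh 3 Lc (Dsh Lc) j) (diagK fun p a => X2s j α κ₁' u' κ₁ u p a - X2s j α κ₁ u κ₁' u' p a) +
                (1 / 2 : ℝ) • (Δ j α κ₁ u κ₁' u' + Δ j α κ₁' u' κ₁ u)))) (GcombSh Lc j) -
                (comp (sandwichDefect (GcombSh Lc j) (bhKStepSh 3 Lc (Dsh Lc) j)
                      (diagK fun p c => ∑ ι, ∑' v, colH (GcombSh Lc j) Lc κ₁ u ι v * (γ j * ctGenM 3 (bhK Lc + Dsh Lc) α Lc ι v p c)))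
                    (comp (dM (GcombSh Lc j) Lc (SpureRecOf 3 Lc (symVhSAt (ctr 4 Lc) 3 Lc rfl) (symHessFFAt (ctr 4 Lc) Lc) (GcombSh Lc) ((Lc : ℝ) ^ 4) (-((Lc : ℝ) ^ 8 / 2)) (κ * cΛ) j) (M1Of 3 Lc (symHessFFAt (ctr 4 Lc) Lc) (κ * cΛ) j) κ₁' u') (GcombSh Lc j) -
                      diagK fun p c => ∑ ι, ∑' v, colH (GcombSh Lc j) Lc κ₁' u' ι v * (γ j * ctGenM 3 (bhK Lc + Dsh Lc) α Lc ι v p c))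
                  + comp (comp (GcombSh Lc j) (dM (GcombSh Lc j) Lc (SpureRecOf 3 Lc (symVhSAt (ctr 4 Lc) 3 Lc rfl) (symHessFFAt (ctr 4 Lc) Lc) (GcombSh Lc) ((Lc : ℝ) ^ 4) (-((Lc : ℝ) ^ 8 / 2)) (κ * cΛ) j) (M1Of 3 Lc (symHessFFAt (ctr 4 Lc) Lc) (κ * cΛ) j) κ₁ u +
                      conjV (bhKStepSh 3 Lc (Dsh Lc) j) (diagK fun p c => ∑ ι, ∑' v, colH (GcombSh Lc j) Lc κ₁ u ι v * (γ j * ctGenM 3 (bhK Lc + Dsh Lc) α Lc ι v p c))))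
                    (sandwichDefect (GcombSh Lc j) (bhKStepSh 3 Lc (Dsh Lc) j)
                      (diagK fun p c => ∑ ι, ∑' v, colH (GcombSh Lc j) Lc κ₁' u' ι v * (γ j * ctGenM 3 (bhK Lc + Dsh Lc) α Lc ι v p c)))
                  + comp (sandwichDefect (GcombSh Lc j) (bhKStepSh 3 Lc (Dsh Lc) j)
                      (diagK fun p c => ∑ ι, ∑' v, colH (GcombSh Lc j) Lc κ₁' u' ι v * (γ j * ctGenM 3 (bhK Lc + Dsh Lc) α Lc ι v p c)))
                    (comp (dM (GcombSh Lc j) Lc (SpureRecOf 3 Lc (symVhSAt (ctr 4 Lc) 3 Lc rfl) (symHessFFAt (ctr 4 Lc) Lc) (GcombSh Lc) ((Lc : ℝ) ^ 4) (-((Lc : ℝ) ^ 8 / 2)) (κ * cΛ) j) (M1Of 3 Lc (symHessFFAt (ctr 4 Lc) Lc) (κ * cΛ) j) κ₁ u) (GcombSh Lc j) -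
                      diagK fun p c => ∑ ι, ∑' v, colH (GcombSh Lc j) Lc κ₁ u ι v * (γ j * ctGenM 3 (bhK Lc + Dsh Lc) α Lc ι v p c))
                  + comp (comp (GcombSh Lc j) (dM (GcombSh Lc j) Lc (SpureRecOf 3 Lc (symVhSAt (ctr 4 Lc) 3 Lc rfl) (symHessFFAt (ctr 4 Lc) Lc) (GcombSh Lc) ((Lc : ℝ) ^ 4) (-((Lc : ℝ) ^ 8 / 2)) (κ * cΛ) j) (M1Of 3 Lc (symHessFFAt (ctr 4 Lc) Lc) (κ * cΛ) j) κ₁' u' +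
                      conjV (bhKStepSh 3 Lc (Dsh Lc) j) (diagK fun p c => ∑ ι, ∑' v, colH (GcombSh Lc j) Lc κ₁' u' ι v * (γ j * ctGenM 3 (bhK Lc + Dsh Lc) α Lc ι v p c))))
                    (sandwichDefect (GcombSh Lc j) (bhKStepSh 3 Lc (Dsh Lc) j)
                      (diagK fun p c => ∑ ι, ∑' v, colH (GcombSh Lc j) Lc κ₁ u ι v * (γ j * ctGenM 3 (bhK Lc + Dsh Lc) α Lc ι v p c)))))) +
            RBr (j + 1) α κ₁ u κ₁' u' +
            conjV (mmRead Lc (GcombSh (d := 3) Lc j))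
              (diagK fun p c => ((Lc : ℝ) ^ 8) * wV4 3 Lc (j + 1) * mmSym Lc (X2s j α κ₁ u κ₁' u') p c - wVH 3 Lc (j + 1) * h2 (j + 1) α κ₁ u κ₁' u' p c)))
    -- the cancellation of the chart-(II) defect against the W-REMAINDER `Rm_j` (the compensator is now IDENTIFIED: `Wc := Rm`, `X₂ := diagK X2s`) — the (N8) object
    (hRm0 : ∀ (j : ℕ) (α μ : Fin 4) (y : Fin 4 → ℤ) (ν : Fin 4) (y' : Fin 4 → ℤ),
      tadpole (GcombSh Lc j)
        ((1 / 2 : ℝ) • conjV (bhKStepSh 3 Lc (Dsh Lc) j) (diagK fun p a => X2s j α ν y' μ y p a - X2s j α μ y ν y' p a) +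
          (1 / 2 : ℝ) • (Δ j α μ y ν y' + Δ j α ν y' μ y)) = 0)
    -- the route theorem's own binders, verbatim
    (a : ℝ) (ha : 0 < a)
    (h12 : B5.Prop12Printed (fam (fun i : ℕ+ × ℕ => ((i.1 : ℕ+) : ℕ)) (fun i => i.1.pos) MvE a ha))
    (h126 : B5.Kernel126_127Printed (kfam (fun i : ℕ+ × ℕ => ((i.1 : ℕ+) : ℕ)) MvE))
    {L : Type*} {SL : Finset L} (hSL : SL.Nonempty) (k : L → Fin 4) {μ ν : Fin 4} (hμν : μ ≠ ν) {Nc : ℝ} (hNc : Nc ≠ 0)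
    (Jc : ∀ m : ℕ, JetData 3 (Lc ^ m))
    (htel : D1Tel Lc (JsB12CombShSym hLc N (symTablesAn1S2w 3 Lc (κ * cΛ) κ) (κ * cΛ) cB) Jc)
    {cc : ℝ} {Mw' : ℕ → ℕ} (hc : 1 ≤ cc) (hMwin : ∀ L : ℕ, 2 ≤ L → 1 ≤ Mw' L ∧ (L : ℝ) ≤ cc * Mw' L) (hML : ∀ L : ℕ, 2 ≤ L → Mw' L ≤ L)
    (hrep : D1Rep Lc Jc Nc μ ν a SL k) :
    D1Drift Lc (JsB12CombShSym hLc N (symTablesAn1S2w 3 Lc (κ * cΛ) κ) (κ * cΛ) cB) Nc μ ν :=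
  d1Drift_JsB12CombShSym_an1TablesS2w_of_bordMixLetters_reflTableLettersRem_D1Tel_D1Rep hLc hL2 hN (κ * cΛ) κ cB RB RB'' RM hcls0 hclsS hRBp hRB''p hRMp hBord0
    hBord0'' hBordS hBordS'' hM₂ hVfm hVmf hVmm hHr γ hγ hlock2 h2 R2 (fun j α κ₁ u ρ w => κ • symRMrAn1 Lc cΛ γ j α κ₁ u ρ w) h0
    (hM2_smul_symMixFFAt hLc κ cΛ γ) X2s Δ hsplit hDg hX2L hΔL RBr hRBrff hBfm hBmf hBmm hR2succ hRm0 a ha h12 h126 hSL k hμν hNc Jc htel hc hMwin hML hrep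

end Summit.QuantumFields.BalabanUV.Beta.CombChartJointEndReflTablesAn1S2MScaled

end
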